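import Summits.CriticalPhenomena.CardyFormulaZ2.Theorems.CardyBoundaryCoulombGasHalfPlaneMarkDensityLawNecessity
import Summits.CriticalPhenomena.CardyFormulaZ2.Theorems.CardyBoundaryCoulombGasHalfPlaneMarkDensityLawEquivalence
import Summits.CriticalPhenomena.CardyFormulaZ2.Theorems.CardyBoundaryCoulombGasHalfPlaneMarkDensityLawMoebiusReduction
import Summits.CriticalPhenomena.CardyFormulaZ2.Theorems.CardyBoundaryCoulombGasHalfPlaneMarkDensityLawPropShapeEquivalence
import Summits.CriticalPhenomena.CardyFormulaZ2.Theorems.CardyBoundaryCoulombGasHalfPlaneMarkDensityLawNoFreeConstant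
import Summits.CriticalPhenomena.CardyFormulaZ2.Theorems.CardyBoundaryCoulombGasHalfPlaneMarkDensityLawAprioriFakeProfile
import Summits.CriticalPhenomena.CardyFormulaZ2.Theorems.CardyBoundaryCoulombGasHalfPlaneMarkDensityLawAprioriStructure
import Summits.CriticalPhenomena.CardyFormulaZ2.Theorems.CardyBoundaryCoulombGasHalfPlaneMarkDensityLawOneArmThirdOfCrux
import Summits.CriticalPhenomena.CardyFormulaZ2.Theorems.CardyBoundaryCoulombGasHalfPlaneMarkDensityLawWiredCardy
import Summits.CriticalPhenomena.CardyFormulaZ2.Theorems.CardyBoundaryCoulombGasHalfPlaneMarkDensityLawFromHalfStrip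
import Summits.CriticalPhenomena.CardyFormulaZ2.Theorems.CardyBoundaryCoulombGasRectilinearCardyDensityIntegration
import Summits.CriticalPhenomena.CardyFormulaZ2.Theorems.HalfPlaneMarkDensityLaw.Negative.OrderHypotheses
import Literature.Probability.Percolation.CardyFormulaConformalInvariance

/-!
# STRATEGY CENSUS (Lean record) — crux `HalfPlaneMarkDensityLaw` (stmt-CriticalPhenomena-5661),
# route CardyBoundaryCoulombGas; crux-strategist seat `cstrat-stmt-CriticalPhenomena-5661-s1` (2026-08-17)

Companion of `Cruxes/HalfPlaneMarkDensityLaw/STRATEGY-CENSUS.md`.  Every typed claim of the census is a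
checked theorem HERE, over LANDED declarations only (no `sorry`, no new percolation mathematics: this
file composes and re-labels tree theorems so that the census can cite one place).  Sections follow the
census: §0 frame (where the crux sits), §T transfer, §S strengthen, §D decomposition, §N negation.

The one-line summary the theorems below certify: the crux is EQUIVALENT to collinear half-plane Cardy
C⁺ for bond-`ℤ²` (`crux_iff_collinearCardy`), is IMPLIED by each of the four summit-grade statements
`CardyFormulaZ2`, `RectilinearCardy` (crux 4), `BoundaryDefectGaussianR` (crux 2, the engine) and
`HalfStripCardyZ2` (route CardyPerronTeleport), is IDLE in the route's deciding theorem
(`closes_without_crux`), and every typed reformulation isolates the same open input — the profile /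
`x`-shape / inversion covariance of the subsequential scaling limits, which the lattice symmetries and
self-duality provably do not force (`profile_not_forced_by_apriori_structure`).
-/

noncomputable section

namespace Summit.CriticalPhenomena.CardyFormulaZ2.Cruxes.HalfPlaneMarkDensityLaw.StrategyCensus

open Literature.Probability.Percolation Literature.Probability.LatticeModels
open Literature.Probability.RandomPlanarGeometry (crossRatio cardyConst)
open MeasureTheory Filter Set
open scoped Topology
open Summit.CriticalPhenomena.CardyFormulaZ2.Theses.CardyBoundaryCoulombGas
open Summit.CriticalPhenomena.CardyFormulaZ2.Theorems.HalfPlaneMarkDensityLaw.Negative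
open Summit.CriticalPhenomena.CardyFormulaZ2.Cruxes.HalfPlaneMarkDensityLaw.SketchLine

/-! ## §0 Frame: where the crux sits in the implication graph of the route -/

/-- **The crux is the collinear half-plane Cardy law C⁺ for bond-`ℤ²`** (lead line `Sketch`:
reduction p91131 + converse; `stub_equivalence` p92261).  Any line for the crux proves C⁺. [folklore] -/
theorem crux_iff_collinearCardy :
    HalfPlaneMarkDensityLaw ↔ ∀ a b c y : ℝ, a < b → b < c → c < y →
      Tendsto (fun n : ℕ ↦ μ.real (openCrossing halfPlane (arcA a b n) (rowIcc ⌊c * n⌋ ⌊y * n⌋))) atTop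
        (𝓝 (Literature.Probability.RandomPlanarGeometry.cardyFunction (crossRatio ![a, b, c, y]))) :=
  stub_equivalence

/-- The conjunct implies the crux (`CardyFormulaZ2 → HalfPlaneMarkDensityLaw`, p95962): a refutation
of the crux refutes the audited sub-problem statement, and no proof of the crux can be "cheaper than
some proof of half-plane Cardy". [folklore] -/
theorem crux_of_conjunct : _root_.CardyFormulaZ2 → HalfPlaneMarkDensityLaw :=
  halfPlaneMarkDensityLaw_of_cardyFormulaZ2

/-- Crux 4 implies the crux (`RectilinearCardy → HalfPlaneMarkDensityLaw`, RSW box exhaustion, p93337);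
and crux 4 IS the conjunct (`rectilinearCardy_iff_cardyFormulaZ2`). [folklore] -/
theorem crux_of_rectilinearCardy :
    (RectilinearCardy → HalfPlaneMarkDensityLaw) ∧ (RectilinearCardy ↔ _root_.CardyFormulaZ2) :=
  ⟨stub_fromRectilinear, rectilinearCardy_iff_cardyFormulaZ2⟩

/-- The ENGINE implies the crux: `BoundaryDefectGaussianR → HalfPlaneMarkDensityLaw`, by the landed
glue `DensityIntegration_proof` (stmt-14890: engine ⇒ crux 4) and box exhaustion.  So the route's own
strengthening of the crux (its rank-2 crux) is already wired to it in the tree. [folklore] -/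
theorem crux_of_engine : BoundaryDefectGaussianR → HalfPlaneMarkDensityLaw :=
  fun h ↦ stub_fromRectilinear (Summit.CriticalPhenomena.CardyFormulaZ2.Theorems.DensityIntegration_proof h)

/-- The cross-route sibling implies the crux: `HalfStripCardyZ2 → HalfPlaneMarkDensityLaw`
(target of route CardyPerronTeleport, stmt-5178; half-strip exhaustion, lead c19). [folklore] -/
theorem crux_of_halfStripCardyZ2 :
    Summit.CriticalPhenomena.CardyFormulaZ2.Theses.CardyPerronTeleport.HalfStripCardyZ2 →
      HalfPlaneMarkDensityLaw :=
  halfPlaneMarkDensityLaw_of_halfStripCardyZ2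

/-- **The crux is an idle binder of the route's deciding theorem.**  `closes` has type
`BoundaryDefectGaussianR → StripClusterRates → RectilinearCardy → HalfPlaneMarkDensityLaw →
HalfPlaneOneArmThird → RectilinearSuffices → CardyFormulaZ2`; the same conclusion follows with the
`HalfPlaneMarkDensityLaw` binder DELETED (and, for that matter, from `RectilinearCardy` and the proved
support `RectilinearSuffices` alone).  Closing or not closing stmt-5661 changes nothing for the route. [folklore] -/
theorem closes_without_crux :
    BoundaryDefectGaussianR → StripClusterRates → RectilinearCardy → HalfPlaneOneArmThird →
      RectilinearSuffices → _root_.CardyFormulaZ2 :=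
  fun _ _ hRC _ hS ↦ hS hRC

/-- … and `RectilinearSuffices` is proved, so crux 4 alone decides the conjunct. [folklore] -/
theorem conjunct_of_rank4_alone : RectilinearCardy → _root_.CardyFormulaZ2 :=
  rectilinearCardy_iff_cardyFormulaZ2.1

/-- What any proof of the crux also proves (downstream, all landed): the half-plane one-arm exponent
`1/3` of bond-`ℤ²` (crux 6, stmt-5662, open; p127899) and the wired three-mark law (target stmt-9321
of route CardyTotalPositivity; p96246). [folklore] -/
theorem consequences_of_crux :
    HalfPlaneMarkDensityLaw →
      HalfPlaneOneArmThird ∧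
        Summit.CriticalPhenomena.CardyFormulaZ2.Theses.CardyTotalPositivity.HalfPlaneWiredCardy :=
  fun h ↦ ⟨OneArm.halfPlaneOneArmThird_of_halfPlaneMarkDensityLaw h,
    halfPlaneWiredCardy_of_halfPlaneMarkDensityLaw h⟩

/-! ## §T Transfer -/

/-- **T1 — the solved sibling's version of exactly this step is a THEOREM of the tree**: Smirnov's
theorem for site percolation on `𝕋` (Cardy's formula in every conformal rectangle; Bollobás–Riordan
Ch. 7, all proved in the tree).  The `𝕋`-analogue of C⁺ follows from it by the `𝕋`-copy of the landed
box exhaustion; what does NOT transfer to bond-`ℤ²` is the proof (colour switching = exact discrete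
`2π/3`-Cauchy–Riemann, barrier `SmirnovTriangularOnly`; FK parafermion at `q = 1`: half of discrete CR,
barrier `FKParafermionicHalfCauchyRiemann`). [cite: Smirnov2001, Thm. 1] -/
theorem transfer_T1_sibling_step_is_theorem : hasCrossingLimit_triDomainCrossingProb :=
  hasCrossingLimit_triDomainCrossingProb_holds

/-- **T4 — every in-tree "transfer" of the crux is a re-hang below a summit-grade item.**  The four
landed sufficient statements, bundled: crux 4, the engine, the half-strip sibling, the conjunct. [folklore] -/
theorem transfer_rehang :
    (RectilinearCardy → HalfPlaneMarkDensityLaw) ∧ (BoundaryDefectGaussianR → HalfPlaneMarkDensityLaw) ∧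
      (Summit.CriticalPhenomena.CardyFormulaZ2.Theses.CardyPerronTeleport.HalfStripCardyZ2 →
          HalfPlaneMarkDensityLaw) ∧
        (_root_.CardyFormulaZ2 → HalfPlaneMarkDensityLaw) :=
  ⟨stub_fromRectilinear, crux_of_engine, crux_of_halfStripCardyZ2, crux_of_conjunct⟩

/-! ## §S Strengthen -/

/-- **S2 — C⁺ with a rate** (the rigid form that could in principle admit induction on scales). [folklore] -/
def CollinearCardyRate : Prop :=
  ∃ ε : ℝ, 0 < ε ∧ ∀ a b c y : ℝ, a < b → b < c → c < y → ∃ C : ℝ, ∀ᶠ n : ℕ in atTop,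
    |μ.real (openCrossing halfPlane (arcA a b n) (rowIcc ⌊c * n⌋ ⌊y * n⌋)) -
        Literature.Probability.RandomPlanarGeometry.cardyFunction (crossRatio ![a, b, c, y])| ≤
      C * (n : ℝ) ^ (-ε)

/-- The rate form implies the crux (squeeze, then the landed reduction).  The converse direction is
where a rate would have to come from: there is no recursion `P_n ↦ P_{2n}` on bond-`ℤ²` beyond the
exact dilation identity, so the added rigidity buys nothing for THIS step (census §S2). [folklore] -/
theorem crux_of_rate : CollinearCardyRate → HalfPlaneMarkDensityLaw := by
  rintro ⟨ε, hε, h⟩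
  refine stub_reduction fun a b c y hab hbc hcy ↦ ?_
  obtain ⟨C, hC⟩ := h a b c y hab hbc hcy
  have h0 : Tendsto (fun n : ℕ ↦ C * (n : ℝ) ^ (-ε)) atTop (𝓝 0) := by
    have h1 : Tendsto (fun n : ℕ ↦ (n : ℝ) ^ (-ε)) atTop (𝓝 0) :=
      (tendsto_rpow_neg_atTop hε).comp tendsto_natCast_atTop_atTop
    simpa using h1.const_mul C
  rw [tendsto_iff_norm_sub_tendsto_zero]
  refine squeeze_zero_norm' ?_ h0
  filter_upwards [hC] with n hn
  simpa [Real.norm_eq_abs] using hn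

/-- **S3 — the engine (route crux 2) is a strengthening of the crux already cashed in the tree**, and it
is summit-complete: it implies the conjunct as well. [folklore] -/
theorem engine_is_summit_complete :
    (BoundaryDefectGaussianR → HalfPlaneMarkDensityLaw) ∧ (BoundaryDefectGaussianR → _root_.CardyFormulaZ2) :=
  ⟨crux_of_engine, fun h ↦ conjunct_of_rank4_alone
    (Summit.CriticalPhenomena.CardyFormulaZ2.Theorems.DensityIntegration_proof h)⟩

/-- **S4 — the constant-free form is NOT weaker**: the density law with SOME constant in place of
`cardyConst/3` is equivalent to the crux (self-duality on the diagonal + `F(1/2) = 1/2` pin the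
constant; `stub_noFreeConstant`).  So "prove the shape, fit the constant later" is the crux itself. [folklore] -/
theorem crux_iff_exists_constant :
    HalfPlaneMarkDensityLaw ↔ ∃ C : ℝ, ∀ a b c x : ℝ, a < b → b < c → c < x →
      Tendsto (fun n : ℕ ↦ (n : ℝ) * (bondPercolation (zdGraph 2) half).real
        (openCrossing {v : Site 2 | 0 ≤ v 1} {v | v 1 = 0 ∧ ⌊a * n⌋ ≤ v 0 ∧ v 0 ≤ ⌊b * n⌋} {![⌊x * n⌋, 0]} \
          openCrossing {v : Site 2 | 0 ≤ v 1} {v | v 1 = 0 ∧ ⌊a * n⌋ ≤ v 0 ∧ v 0 ≤ ⌊b * n⌋}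
            {v | v 1 = 0 ∧ ⌊c * n⌋ ≤ v 0 ∧ v 0 < ⌊x * n⌋})) atTop
        (𝓝 (C * ((b - a) * (c - b) * (c - a)) ^ (1 / 3 : ℝ) * ((x - a) * (x - b) * (x - c)) ^ (-(2 / 3) : ℝ))) :=
  halfPlaneMarkDensityLaw_iff_exists_constant

/-! ## §D Decomposition -/

/-- Piece 1 of the Möbius split: EXISTENCE of the full scaling limit of the half-plane four-arc crossing
probability of bond-`ℤ²` (convergence on the whole chamber to `G`). [folklore] -/
def FullLimit (G : ℝ → ℝ → ℝ → ℝ → ℝ) : Prop :=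
  ∀ a b c y : ℝ, a < b → b < c → c < y →
    Tendsto (fun n : ℕ ↦ μ.real (openCrossing halfPlane (arcA a b n) (rowIcc ⌊c * n⌋ ⌊y * n⌋)))
      atTop (𝓝 (G a b c y))

/-- Piece 2: INVERSION COVARIANCE of the limit on positive quadruples — the one Möbius generator of `ℍ`
that no lattice symmetry, no existence statement and no rotation theorem supplies. [folklore] -/
def InversionCovariant (G : ℝ → ℝ → ℝ → ℝ → ℝ) : Prop :=
  ∀ a b c y : ℝ, 0 < a → a < b → b < c → c < y → G (-1 / a) (-1 / b) (-1 / c) (-1 / y) = G a b c y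

/-- Piece 3: Cardy's PROFILE along the single normal family `(0, t, 1, 2)`, `0 < t < 1`. [folklore] -/
def NormalFamilyProfile (G : ℝ → ℝ → ℝ → ℝ → ℝ) : Prop :=
  ∀ t : ℝ, 0 < t → t < 1 → G 0 t 1 2 = Literature.Probability.RandomPlanarGeometry.cardyFunction (t / (2 - t))

/-- **D1 — the best typed split, both directions PROVED** (lead c2-0's Möbius reduction, p111256):
`crux ⟺ ∃ G, FullLimit G ∧ InversionCovariant G ∧ NormalFamilyProfile G`. [folklore] -/
theorem crux_iff_split3 :
    HalfPlaneMarkDensityLaw ↔ ∃ G, FullLimit G ∧ InversionCovariant G ∧ NormalFamilyProfile G := by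
  unfold FullLimit InversionCovariant NormalFamilyProfile
  exact stub_moebiusReduction

/-- The glue of D1 in the protocol's shape `Sub₁ → Sub₂ → Sub₃ → Crux` (for a common witness `G`). [folklore] -/
theorem crux_of_subs (G : ℝ → ℝ → ℝ → ℝ → ℝ) :
    FullLimit G → InversionCovariant G → NormalFamilyProfile G → HalfPlaneMarkDensityLaw :=
  fun h1 h2 h3 ↦ crux_iff_split3.2 ⟨G, h1, h2, h3⟩

/-- Conversely each piece is NECESSARY (with the witness `G = F ∘ η`), so none is a free hypothesis. [folklore] -/
theorem subs_of_crux :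
    HalfPlaneMarkDensityLaw → ∃ G, FullLimit G ∧ InversionCovariant G ∧ NormalFamilyProfile G :=
  crux_iff_split3.1

/-- **D2 — the shape split has exactly one open piece and it is the crux**: `HalfPlaneMarkDensityLaw`
holds iff for every joint subsequential limit `G` (they exist, c2-0) and all `a < b < c`,
`x ↦ ∂₄G(a,b,c,x)·((x−a)(x−b)(x−c))^{2/3}` is constant on `(c,∞)` (lead c12-0, p133969).
Normalisation and `(a,b,c)`-dependence are forced by lattice symmetries + self-duality. [folklore] -/
theorem crux_iff_shape :
    HalfPlaneMarkDensityLaw ↔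
    ∀ θ : ℕ → ℕ, StrictMono θ → ∀ G : ℝ → ℝ → ℝ → ℝ → ℝ,
      (∀ a b c y : ℝ, a < b → b < c → c < y →
        Tendsto (fun n ↦ μ.real (openCrossing halfPlane (arcA a b (θ n))
          (rowIcc ⌊c * (θ n : ℕ)⌋ ⌊y * (θ n : ℕ)⌋))) atTop (𝓝 (G a b c y))) →
      ∀ a b c : ℝ, a < b → b < c → ∃ K : ℝ, ∀ x : ℝ, c < x →
        deriv (G a b c) x * ((x - a) * (x - b) * (x - c)) ^ ((2 : ℝ) / 3) = K :=
  Proportional.halfPlaneMarkDensityLaw_iff_shape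

/-- **D3 — the exponent split**: the crux implies the half-plane one-arm exponent `1/3` (crux 6, open on
`ℤ²`); the converse is not available (an exponent does not give a profile), so the piece "shape given
the exponents" remains the whole crux. [folklore] -/
theorem oneArmThird_of_crux : HalfPlaneMarkDensityLaw → HalfPlaneOneArmThird :=
  OneArm.halfPlaneOneArmThird_of_halfPlaneMarkDensityLaw

/-! ## §N Negation -/

/-- **N1 — the order hypotheses are load-bearing and nothing else is junk-refutable** (cdisprove gen 1.5,
landed `Negative/OrderHypotheses`): dropping `a < b`, `b < c` or `c < x` makes the law false. [folklore] -/
theorem order_hypotheses_loadBearing :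
    (¬ ∀ a b c x : ℝ, b < c → c < x → Tendsto (lawSeq a b c x) atTop (𝓝 (density a b c x))) ∧
    (¬ ∀ a b c x : ℝ, a < b → c < x → Tendsto (lawSeq a b c x) atTop (𝓝 (density a b c x))) ∧
    (¬ ∀ a b c x : ℝ, a < b → b < c → Tendsto (lawSeq a b c x) atTop (𝓝 (density a b c x))) :=
  ⟨law_false_without_hab, law_false_without_hbc, law_false_without_hcx⟩

/-- **N2 — a counterexample to the crux is a counterexample to the summit** (and to crux 4, the engine,
and the half-strip sibling): the negation cannot be cheaper than `¬CardyFormulaZ2`. [folklore] -/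
theorem negation_refutes_summit :
    ¬ HalfPlaneMarkDensityLaw →
      ¬ _root_.CardyFormulaZ2 ∧ ¬ RectilinearCardy ∧ ¬ BoundaryDefectGaussianR ∧
        ¬ Summit.CriticalPhenomena.CardyFormulaZ2.Theses.CardyPerronTeleport.HalfStripCardyZ2 :=
  fun h ↦ ⟨mt crux_of_conjunct h, mt stub_fromRectilinear h, mt crux_of_engine h,
    mt crux_of_halfStripCardyZ2 h⟩

/-- **N3 — the obstruction to a counterexample, typed: the a-priori class does not single out `F`.**
There is a profile `g ≠ F` with every property the lattice symmetries, RSW and self-duality give the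
joint subsequential limits (`g(0)=0`, `g(1)=1`, strictly increasing, continuous, `C¹` with positive
derivative inside, `g(1−u) = 1 − g(u)`) — lead c12-0's `Apriori.stub_fakeProfile` (p133309).  So neither a
proof NOR a refutation of the crux can come from that class; the missing input is the same on both
sides (a `ℤ²` observable / the engine), and the obstruction is a barrier note, not a stub. [folklore] -/
theorem profile_not_forced_by_apriori_structure :
    ∃ g : ℝ → ℝ, (∃ u ∈ Set.Ioo (0 : ℝ) 1, g u ≠ Literature.Probability.RandomPlanarGeometry.cardyFunction u) ∧
      g 0 = 0 ∧ g 1 = 1 ∧ StrictMonoOn g (Set.Icc 0 1) ∧ ContinuousOn g (Set.Icc 0 1) ∧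
      (∀ u ∈ Set.Ioo (0 : ℝ) 1, DifferentiableAt ℝ g u ∧ 0 < deriv g u) ∧
      ∀ u ∈ Set.Icc (0 : ℝ) 1, g (1 - u) = 1 - g u :=
  Apriori.stub_fakeProfile

/-- **N4 — what IS known unconditionally about the objects of the crux** (the saturated a-priori theory,
lead c12-0's bundling theorem `Apriori.jointLimit_structure`, restated): along a subsequence of every
subsequence the half-plane four-arc crossing probability converges on the chamber to a `G` with values
in `(0,1)`, all four partials of the recorded signs, translation and reflection invariance, and gap
closing.  Identification of `G` (= the crux, `crux_iff_shape`) is the only missing statement. [folklore] -/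
theorem apriori_structure :
    ∀ (φ : ℕ → ℕ), StrictMono φ → ∃ ψ : ℕ → ℕ, StrictMono ψ ∧ ∃ G : ℝ → ℝ → ℝ → ℝ → ℝ,
      (∀ a b c y : ℝ, a < b → b < c → c < y →
        Tendsto (fun n ↦ μ.real (openCrossing halfPlane (arcA a b (φ (ψ n)))
          (rowIcc ⌊c * (φ (ψ n) : ℕ)⌋ ⌊y * (φ (ψ n) : ℕ)⌋))) atTop (𝓝 (G a b c y))) ∧
      (∀ a b c y : ℝ, a < b → b < c → c < y →
        (0 < G a b c y ∧ G a b c y < 1) ∧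
        (deriv (fun s ↦ G s b c y) a < 0 ∧ 0 < deriv (fun s ↦ G a s c y) b ∧
          deriv (fun s ↦ G a b s y) c < 0 ∧ 0 < deriv (G a b c) y) ∧
        (DifferentiableAt ℝ (fun s ↦ G s b c y) a ∧ DifferentiableAt ℝ (fun s ↦ G a s c y) b ∧
          DifferentiableAt ℝ (fun s ↦ G a b s y) c ∧ DifferentiableAt ℝ (fun s ↦ G a b c s) y) ∧
        (∀ t : ℝ, G (a + t) (b + t) (c + t) (y + t) = G a b c y) ∧
        G (-y) (-c) (-b) (-a) = G a b c y) ∧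
      (∀ a b y : ℝ, a < b → b < y → Tendsto (fun c ↦ G a b c y) (𝓝[>] b) (𝓝 1)) :=
  Apriori.jointLimit_structure

end Summit.CriticalPhenomena.CardyFormulaZ2.Cruxes.HalfPlaneMarkDensityLaw.StrategyCensus

end
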